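/-
Copyright (c) 2026 the pub-hodgecm-mathlib formalisation cell (harness21).  Prover seat hodgecm-mathlib-K2E4-p06 (g2), Track B ∕ K2-LIT (build stream 29),
h413 = `stmt-HodgeConjecture-24833`, line (ii′) (lead: this seat), sub-letter (H): independence of the non-central germs from the constants, from (H♭) «homogeneity along one
elliptic sequence» — a constant that eventually equals a diverging multiple is zero.  2026-09-04.
-/
import Summits.HodgeConjecture.HodgeConjecture.Theorems.K2E3SingularTransferSignedOfLimitFormulas   -- ★ p855452 (this seat): the frame-light imports
import HarnessLib

/-!
# h413 ∕ Track B «K2-LIT», line (ii′), sub-letter (H) — ‹(H♭) homogeneity along an elliptic sequence› → ‹(H) independence of the non-central germs› (helper, `--supports`)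

Cell `pub/hodgecm-mathlib`, crux H413 = `stmt-HodgeConjecture-24833`, route `HCCMUnconditional`; dealer-of-record K2E3-plan (g1); line (ii′) lead K2E4-p06 (g2) (MEMO (ii) 77d54c9e).
THEOREMS ONLY (no `def`, no `instance`, no `notation`, no `sorry`, default heartbeats); count-neutral.  Hypothesis = cand (H♭) `sig_K2E3CentralGermHomogeneity`; conclusion = cand (H)
`sig_K2E3CentralGermIndependence` (abbe57174b18d6b3) VERBATIM.
* `eq_zero_of_eventually_add_mul_eq_zero` — frame-free: `w_n → +∞`, `c₀ + w_n·K = 0` eventually ⇒ `c₀ = 0` (if `K ≠ 0` then `w_n = −c₀∕K` is eventually constant,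
  contradicting divergence; so `K = 0`, whence `c₀ = 0`).
* `centralGermIndependence_of_homogeneity : ‹(H♭)› → ‹(H)›` — pull the eventual identity `c₀ + Σ_u a_u Γ_u(γ) = 0` back along `ρ_n → 𝓕_ell(z)`, substitute
  `Γ_u(ρ_n) = w_n·K_u` (the central coefficient is `0`), and apply the frame-free lemma with `K := Σ_u a_u K_u`.
[Rogawski1990 §8.1 Prop. 8.1.2 (b) pp. 114–115; (8.1.1)–(8.1.2) p. 117.]
HONEST LABEL: HC_CM is proved only modulo the 7 printed citations (2 remaining named inputs: hLiu418 = stmt-HodgeConjecture-24832, h413 = stmt-HodgeConjecture-24833) until rung 0 closes; implication only — (H♭) is E3's letter.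

## References
* [Rogawski1990] J. D. Rogawski, *Automorphic Representations of Unitary Groups in Three Variables*, Ann. of Math. Stud. 123 (1990): §8.1 Prop. 8.1.2 pp. 114–115, (8.1.1)–(8.1.2) p. 117.
-/

set_option autoImplicit false
set_option linter.dupNamespace false

noncomputable section

open Filter Topology
open MeasureTheory Measure NumberField IsDedekindDomain
open Literature.MeasureTheory.Group Literature.MeasureTheory.RestrictedProduct
open Literature.Topology.RestrictedProduct Literature.Topology.Algebra.RestrictedProduct
open Literature.NumberTheory.Rogawski1990 Literature.NumberTheory.Automorphic
open Literature.AlgebraicGeometry.ShimuraVarieties (unitaryGroup hermForm)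
open scoped Matrix MatrixGroups RestrictedProduct

namespace Summit.HodgeConjecture.HodgeConjecture.Cruxes.H413.K2E3CentralGermIndependenceOfHomogeneity

/-- **A CONSTANT THAT EVENTUALLY EQUALS A DIVERGING MULTIPLE IS ZERO** (frame-free): `w_n → +∞` and `c₀ + w_n·K = 0` for all large `n` force `c₀ = 0`.
[cite: Rogawski1990, §8.1 (8.1.1)–(8.1.2) p. 117] -/
theorem eq_zero_of_eventually_add_mul_eq_zero {c₀ K : ℂ} {w : ℕ → ℝ} (hw : Tendsto w atTop atTop)
    (h : ∀ᶠ n in atTop, c₀ + (w n : ℂ) * K = 0) : c₀ = 0 := by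
  by_cases hK : K = 0
  · obtain ⟨n, hn⟩ := h.exists
    simpa [hK] using hn
  · -- two large indices with different weights give a contradiction
    obtain ⟨N, hN⟩ := eventually_atTop.1 h
    have h1 := hN N le_rfl
    obtain ⟨M, hM⟩ := eventually_atTop.1 (hw.eventually_gt_atTop (w N))
    have h2 := hN (max N M) (le_max_left _ _)
    have hgt : w N < w (max N M) := hM (max N M) (le_max_right _ _)
    have heq : (w N : ℂ) * K = (w (max N M) : ℂ) * K := by linear_combination h1 - h2
    have : (w N : ℂ) = (w (max N M) : ℂ) := mul_right_cancel₀ hK heq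
    exact absurd (by exact_mod_cast this : w N = w (max N M)) hgt.ne

/-- **(H) FROM (H♭)** (bytes VERBATIM): along the elliptic sequence `ρ_n → 𝓕_ell(z)` of (H♭), the eventual identity `c₀ + Σ_u a_u Γ_u(γ) = 0` reads `c₀ + w_n·(Σ_u a_u K_u) = 0`
for large `n` (the central coefficient vanishes), and `w_n → +∞`. [cite: Rogawski1990, §8.1 Prop. 8.1.2 (b) pp. 114–115; (8.1.1)–(8.1.2) p. 117] -/
theorem centralGermIndependence_of_homogeneity
    (hHb :
    ∀ (L : Type) [Field L] [NumberField L] [IsCMField L] (H' : Matrix (Fin 3) (Fin 3) L),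
      (H'.map (cmConjRingHom L)).transpose = H' →
      (∀ x : Fin 3 → L, hermForm (cmConjRingHom L) H' x x = 0 → x = 0) →
    ∀ (v : HeightOneSpectrum (𝓞 ↥(maximalRealSubfield L)))
      [MeasurableSpace ((UnitaryGroup.cmDatum L 2 (Matrix.of fun i j : Fin 2 => if i.val + j.val + 1 = 2 then (1 : L) else 0)).Local v × (UnitaryGroup.cmDatum L 1 (Matrix.of fun i j : Fin 1 => if i.val + j.val + 1 = 1 then (1 : L) else 0)).Local v)] [BorelSpace ((UnitaryGroup.cmDatum L 2 (Matrix.of fun i j : Fin 2 => if i.val + j.val + 1 = 2 then (1 : L) else 0)).Local v × (UnitaryGroup.cmDatum L 1 (Matrix.of fun i j : Fin 1 => if i.val + j.val + 1 = 1 then (1 : L) else 0)).Local v)]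
      [∀ a : (UnitaryGroup.cmDatum L 2 (Matrix.of fun i j : Fin 2 => if i.val + j.val + 1 = 2 then (1 : L) else 0)).Local v × (UnitaryGroup.cmDatum L 1 (Matrix.of fun i j : Fin 1 => if i.val + j.val + 1 = 1 then (1 : L) else 0)).Local v,
        MeasurableSpace (((UnitaryGroup.cmDatum L 2 (Matrix.of fun i j : Fin 2 => if i.val + j.val + 1 = 2 then (1 : L) else 0)).Local v × (UnitaryGroup.cmDatum L 1 (Matrix.of fun i j : Fin 1 => if i.val + j.val + 1 = 1 then (1 : L) else 0)).Local v) ⧸ Subgroup.centralizer ({a} : Set ((UnitaryGroup.cmDatum L 2 (Matrix.of fun i j : Fin 2 => if i.val + j.val + 1 = 2 then (1 : L) else 0)).Local v × (UnitaryGroup.cmDatum L 1 (Matrix.of fun i j : Fin 1 => if i.val + j.val + 1 = 1 then (1 : L) else 0)).Local v)))]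
      [∀ a : (UnitaryGroup.cmDatum L 2 (Matrix.of fun i j : Fin 2 => if i.val + j.val + 1 = 2 then (1 : L) else 0)).Local v × (UnitaryGroup.cmDatum L 1 (Matrix.of fun i j : Fin 1 => if i.val + j.val + 1 = 1 then (1 : L) else 0)).Local v,
        BorelSpace (((UnitaryGroup.cmDatum L 2 (Matrix.of fun i j : Fin 2 => if i.val + j.val + 1 = 2 then (1 : L) else 0)).Local v × (UnitaryGroup.cmDatum L 1 (Matrix.of fun i j : Fin 1 => if i.val + j.val + 1 = 1 then (1 : L) else 0)).Local v) ⧸ Subgroup.centralizer ({a} : Set ((UnitaryGroup.cmDatum L 2 (Matrix.of fun i j : Fin 2 => if i.val + j.val + 1 = 2 then (1 : L) else 0)).Local v × (UnitaryGroup.cmDatum L 1 (Matrix.of fun i j : Fin 1 => if i.val + j.val + 1 = 1 then (1 : L) else 0)).Local v)))]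
      [MeasurableSpace ((UnitaryGroup.cmDatum L 3 H').Local v)] [BorelSpace ((UnitaryGroup.cmDatum L 3 H').Local v)]
      [∀ γ : (UnitaryGroup.cmDatum L 3 H').Local v, MeasurableSpace ((UnitaryGroup.cmDatum L 3 H').Local v ⧸ Subgroup.centralizer ({γ} : Set ((UnitaryGroup.cmDatum L 3 H').Local v)))]
      [∀ γ : (UnitaryGroup.cmDatum L 3 H').Local v, BorelSpace ((UnitaryGroup.cmDatum L 3 H').Local v ⧸ Subgroup.centralizer ({γ} : Set ((UnitaryGroup.cmDatum L 3 H').Local v)))]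
      (νHv : Measure ((UnitaryGroup.cmDatum L 2 (Matrix.of fun i j : Fin 2 => if i.val + j.val + 1 = 2 then (1 : L) else 0)).Local v × (UnitaryGroup.cmDatum L 1 (Matrix.of fun i j : Fin 1 => if i.val + j.val + 1 = 1 then (1 : L) else 0)).Local v)) (νGv : Measure ((UnitaryGroup.cmDatum L 3 H').Local v))
      [IsFiniteMeasureOnCompacts νHv] [νHv.IsMulRightInvariant] [νGv.IsHaarMeasure] [νGv.IsMulRightInvariant]
      (Δv : LocalTransferFactor L H' v)
      (mHv : OrbitalMeasureFamily ((UnitaryGroup.cmDatum L 2 (Matrix.of fun i j : Fin 2 => if i.val + j.val + 1 = 2 then (1 : L) else 0)).Local v × (UnitaryGroup.cmDatum L 1 (Matrix.of fun i j : Fin 1 => if i.val + j.val + 1 = 1 then (1 : L) else 0)).Local v)) (mGv : OrbitalMeasureFamily ((UnitaryGroup.cmDatum L 3 H').Local v)),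
      IsLocalTransferDatum L H' v Δv mHv mGv →
      mHv.IsCanonical (IsLocalGRegular L v) νHv →
      mGv.IsCanonical (fun γ : (UnitaryGroup.cmDatum L 3 H').Local v => IsRegularElt (γ.val : GL (Fin 3) (UnitaryGroup.LocalRing L v))) νGv →
      Subsingleton (UnitaryGroup.PlacesOver L v) →
    ∀ z : (UnitaryGroup.cmDatum L 2 (Matrix.of fun i j : Fin 2 => if i.val + j.val + 1 = 2 then (1 : L) else 0)).Local v × (UnitaryGroup.cmDatum L 1 (Matrix.of fun i j : Fin 1 => if i.val + j.val + 1 = 1 then (1 : L) else 0)).Local v, z ∈ Subgroup.center ((UnitaryGroup.cmDatum L 2 (Matrix.of fun i j : Fin 2 => if i.val + j.val + 1 = 2 then (1 : L) else 0)).Local v × (UnitaryGroup.cmDatum L 1 (Matrix.of fun i j : Fin 1 => if i.val + j.val + 1 = 1 then (1 : L) else 0)).Local v) →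
    ∀ (S : Finset (ConjClasses ((UnitaryGroup.cmDatum L 2 (Matrix.of fun i j : Fin 2 => if i.val + j.val + 1 = 2 then (1 : L) else 0)).Local v × (UnitaryGroup.cmDatum L 1 (Matrix.of fun i j : Fin 1 => if i.val + j.val + 1 = 1 then (1 : L) else 0)).Local v))) (mU : OrbitalMeasureFamily ((UnitaryGroup.cmDatum L 2 (Matrix.of fun i j : Fin 2 => if i.val + j.val + 1 = 2 then (1 : L) else 0)).Local v × (UnitaryGroup.cmDatum L 1 (Matrix.of fun i j : Fin 1 => if i.val + j.val + 1 = 1 then (1 : L) else 0)).Local v))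
      (Γ : ConjClasses ((UnitaryGroup.cmDatum L 2 (Matrix.of fun i j : Fin 2 => if i.val + j.val + 1 = 2 then (1 : L) else 0)).Local v × (UnitaryGroup.cmDatum L 1 (Matrix.of fun i j : Fin 1 => if i.val + j.val + 1 = 1 then (1 : L) else 0)).Local v) → (UnitaryGroup.cmDatum L 2 (Matrix.of fun i j : Fin 2 => if i.val + j.val + 1 = 2 then (1 : L) else 0)).Local v × (UnitaryGroup.cmDatum L 1 (Matrix.of fun i j : Fin 1 => if i.val + j.val + 1 = 1 then (1 : L) else 0)).Local v → ℂ),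
      ConjClasses.mk z ∈ S →
      (∀ u ∈ S, ((((Quotient.out u * z⁻¹).1).val : GL (Fin 2) (UnitaryGroup.LocalRing L v)).val - 1) ^ 2 = 0 ∧ (Quotient.out u * z⁻¹).2 = 1) →
      mU.IsAdmissibleOn (fun γ : (UnitaryGroup.cmDatum L 2 (Matrix.of fun i j : Fin 2 => if i.val + j.val + 1 = 2 then (1 : L) else 0)).Local v × (UnitaryGroup.cmDatum L 1 (Matrix.of fun i j : Fin 1 => if i.val + j.val + 1 = 1 then (1 : L) else 0)).Local v => ConjClasses.mk γ ∈ S) →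
      (∀ u ∈ S, ∀ fH : (UnitaryGroup.cmDatum L 2 (Matrix.of fun i j : Fin 2 => if i.val + j.val + 1 = 2 then (1 : L) else 0)).Local v × (UnitaryGroup.cmDatum L 1 (Matrix.of fun i j : Fin 1 => if i.val + j.val + 1 = 1 then (1 : L) else 0)).Local v → ℂ, IsLocSmooth fH →
        Integrable (descConj (Quotient.out u : (UnitaryGroup.cmDatum L 2 (Matrix.of fun i j : Fin 2 => if i.val + j.val + 1 = 2 then (1 : L) else 0)).Local v × (UnitaryGroup.cmDatum L 1 (Matrix.of fun i j : Fin 1 => if i.val + j.val + 1 = 1 then (1 : L) else 0)).Local v) (Subgroup.centralizer ({(Quotient.out u : (UnitaryGroup.cmDatum L 2 (Matrix.of fun i j : Fin 2 => if i.val + j.val + 1 = 2 then (1 : L) else 0)).Local v × (UnitaryGroup.cmDatum L 1 (Matrix.of fun i j : Fin 1 => if i.val + j.val + 1 = 1 then (1 : L) else 0)).Local v)} : Set ((UnitaryGroup.cmDatum L 2 (Matrix.of fun i j : Fin 2 => if i.val + j.val + 1 = 2 then (1 : L) else 0)).Local v × (UnitaryGroup.cmDatum L 1 (Matrix.of fun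 i j : Fin 1 => if i.val + j.val + 1 = 1 then (1 : L) else 0)).Local v)))
          (fun _ hg => Subgroup.mem_centralizer_singleton_iff.1 hg) fH) (mU u)) →
      (∀ fH : (UnitaryGroup.cmDatum L 2 (Matrix.of fun i j : Fin 2 => if i.val + j.val + 1 = 2 then (1 : L) else 0)).Local v × (UnitaryGroup.cmDatum L 1 (Matrix.of fun i j : Fin 1 => if i.val + j.val + 1 = 1 then (1 : L) else 0)).Local v → ℂ, IsLocSmooth fH → ∀ᶠ γ in 𝓝[{γ : (UnitaryGroup.cmDatum L 2 (Matrix.of fun i j : Fin 2 => if i.val + j.val + 1 = 2 then (1 : L) else 0)).Local v × (UnitaryGroup.cmDatum L 1 (Matrix.of fun i j : Fin 1 => if i.val + j.val + 1 = 1 then (1 : L) else 0)).Local v |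
            IsLocalGRegular L v γ ∧ CompactSpace (Subgroup.centralizer ({γ} : Set ((UnitaryGroup.cmDatum L 2 (Matrix.of fun i j : Fin 2 => if i.val + j.val + 1 = 2 then (1 : L) else 0)).Local v × (UnitaryGroup.cmDatum L 1 (Matrix.of fun i j : Fin 1 => if i.val + j.val + 1 = 1 then (1 : L) else 0)).Local v)))}] z,
          stableOrbitalIntegralRel (IsLocalStablyConjH L v) mHv fH γ = ∑ u ∈ S, classOrbitalIntegral mU fH u * Γ u γ) →
    ∃ (ρ : ℕ → (UnitaryGroup.cmDatum L 2 (Matrix.of fun i j : Fin 2 => if i.val + j.val + 1 = 2 then (1 : L) else 0)).Local v × (UnitaryGroup.cmDatum L 1 (Matrix.of fun i j : Fin 1 => if i.val + j.val + 1 = 1 then (1 : L) else 0)).Local v) (w : ℕ → ℝ), Tendsto ρ atTop (𝓝[{γ : (UnitaryGroup.cmDatum L 2 (Matrix.of fun i j : Fin 2 => if i.val + j.val + 1 = 2 then (1 : L) else 0)).Local v × (UnitaryGroup.cmDatum L 1 (Matrix.of fun i j : Fin 1 => if i.val + j.val + 1 = 1 then (1 : L) else 0)).Local v |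
            IsLocalGRegular L v γ ∧ CompactSpace (Subgroup.centralizer ({γ} : Set ((UnitaryGroup.cmDatum L 2 (Matrix.of fun i j : Fin 2 => if i.val + j.val + 1 = 2 then (1 : L) else 0)).Local v × (UnitaryGroup.cmDatum L 1 (Matrix.of fun i j : Fin 1 => if i.val + j.val + 1 = 1 then (1 : L) else 0)).Local v)))}] z) ∧ Tendsto w atTop atTop ∧
      ∀ u ∈ S, u ≠ ConjClasses.mk z → ∃ K : ℂ, ∀ᶠ n in atTop, Γ u (ρ n) = (w n : ℂ) * K) :
    ∀ (L : Type) [Field L] [NumberField L] [IsCMField L] (H' : Matrix (Fin 3) (Fin 3) L),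
      (H'.map (cmConjRingHom L)).transpose = H' →
      (∀ x : Fin 3 → L, hermForm (cmConjRingHom L) H' x x = 0 → x = 0) →
    ∀ (v : HeightOneSpectrum (𝓞 ↥(maximalRealSubfield L)))
      [MeasurableSpace ((UnitaryGroup.cmDatum L 2 (Matrix.of fun i j : Fin 2 => if i.val + j.val + 1 = 2 then (1 : L) else 0)).Local v × (UnitaryGroup.cmDatum L 1 (Matrix.of fun i j : Fin 1 => if i.val + j.val + 1 = 1 then (1 : L) else 0)).Local v)] [BorelSpace ((UnitaryGroup.cmDatum L 2 (Matrix.of fun i j : Fin 2 => if i.val + j.val + 1 = 2 then (1 : L) else 0)).Local v × (UnitaryGroup.cmDatum L 1 (Matrix.of fun i j : Fin 1 => if i.val + j.val + 1 = 1 then (1 : L) else 0)).Local v)]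
      [∀ a : (UnitaryGroup.cmDatum L 2 (Matrix.of fun i j : Fin 2 => if i.val + j.val + 1 = 2 then (1 : L) else 0)).Local v × (UnitaryGroup.cmDatum L 1 (Matrix.of fun i j : Fin 1 => if i.val + j.val + 1 = 1 then (1 : L) else 0)).Local v,
        MeasurableSpace (((UnitaryGroup.cmDatum L 2 (Matrix.of fun i j : Fin 2 => if i.val + j.val + 1 = 2 then (1 : L) else 0)).Local v × (UnitaryGroup.cmDatum L 1 (Matrix.of fun i j : Fin 1 => if i.val + j.val + 1 = 1 then (1 : L) else 0)).Local v) ⧸ Subgroup.centralizer ({a} : Set ((UnitaryGroup.cmDatum L 2 (Matrix.of fun i j : Fin 2 => if i.val + j.val + 1 = 2 then (1 : L) else 0)).Local v × (UnitaryGroup.cmDatum L 1 (Matrix.of fun i j : Fin 1 => if i.val + j.val + 1 = 1 then (1 : L) else 0)).Local v)))]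
      [∀ a : (UnitaryGroup.cmDatum L 2 (Matrix.of fun i j : Fin 2 => if i.val + j.val + 1 = 2 then (1 : L) else 0)).Local v × (UnitaryGroup.cmDatum L 1 (Matrix.of fun i j : Fin 1 => if i.val + j.val + 1 = 1 then (1 : L) else 0)).Local v,
        BorelSpace (((UnitaryGroup.cmDatum L 2 (Matrix.of fun i j : Fin 2 => if i.val + j.val + 1 = 2 then (1 : L) else 0)).Local v × (UnitaryGroup.cmDatum L 1 (Matrix.of fun i j : Fin 1 => if i.val + j.val + 1 = 1 then (1 : L) else 0)).Local v) ⧸ Subgroup.centralizer ({a} : Set ((UnitaryGroup.cmDatum L 2 (Matrix.of fun i j : Fin 2 => if i.val + j.val + 1 = 2 then (1 : L) else 0)).Local v × (UnitaryGroup.cmDatum L 1 (Matrix.of fun i j : Fin 1 => if i.val + j.val + 1 = 1 then (1 : L) else 0)).Local v)))]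
      [MeasurableSpace ((UnitaryGroup.cmDatum L 3 H').Local v)] [BorelSpace ((UnitaryGroup.cmDatum L 3 H').Local v)]
      [∀ γ : (UnitaryGroup.cmDatum L 3 H').Local v, MeasurableSpace ((UnitaryGroup.cmDatum L 3 H').Local v ⧸ Subgroup.centralizer ({γ} : Set ((UnitaryGroup.cmDatum L 3 H').Local v)))]
      [∀ γ : (UnitaryGroup.cmDatum L 3 H').Local v, BorelSpace ((UnitaryGroup.cmDatum L 3 H').Local v ⧸ Subgroup.centralizer ({γ} : Set ((UnitaryGroup.cmDatum L 3 H').Local v)))]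
      (νHv : Measure ((UnitaryGroup.cmDatum L 2 (Matrix.of fun i j : Fin 2 => if i.val + j.val + 1 = 2 then (1 : L) else 0)).Local v × (UnitaryGroup.cmDatum L 1 (Matrix.of fun i j : Fin 1 => if i.val + j.val + 1 = 1 then (1 : L) else 0)).Local v)) (νGv : Measure ((UnitaryGroup.cmDatum L 3 H').Local v))
      [IsFiniteMeasureOnCompacts νHv] [νHv.IsMulRightInvariant] [νGv.IsHaarMeasure] [νGv.IsMulRightInvariant]
      (Δv : LocalTransferFactor L H' v)
      (mHv : OrbitalMeasureFamily ((UnitaryGroup.cmDatum L 2 (Matrix.of fun i j : Fin 2 => if i.val + j.val + 1 = 2 then (1 : L) else 0)).Local v × (UnitaryGroup.cmDatum L 1 (Matrix.of fun i j : Fin 1 => if i.val + j.val + 1 = 1 then (1 : L) else 0)).Local v)) (mGv : OrbitalMeasureFamily ((UnitaryGroup.cmDatum L 3 H').Local v)),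
      IsLocalTransferDatum L H' v Δv mHv mGv →
      mHv.IsCanonical (IsLocalGRegular L v) νHv →
      mGv.IsCanonical (fun γ : (UnitaryGroup.cmDatum L 3 H').Local v => IsRegularElt (γ.val : GL (Fin 3) (UnitaryGroup.LocalRing L v))) νGv →
      Subsingleton (UnitaryGroup.PlacesOver L v) →
    ∀ z : (UnitaryGroup.cmDatum L 2 (Matrix.of fun i j : Fin 2 => if i.val + j.val + 1 = 2 then (1 : L) else 0)).Local v × (UnitaryGroup.cmDatum L 1 (Matrix.of fun i j : Fin 1 => if i.val + j.val + 1 = 1 then (1 : L) else 0)).Local v, z ∈ Subgroup.center ((UnitaryGroup.cmDatum L 2 (Matrix.of fun i j : Fin 2 => if i.val + j.val + 1 = 2 then (1 : L) else 0)).Local v × (UnitaryGroup.cmDatum L 1 (Matrix.of fun i j : Fin 1 => if i.val + j.val + 1 = 1 then (1 : L) else 0)).Local v) →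
    ∀ (S : Finset (ConjClasses ((UnitaryGroup.cmDatum L 2 (Matrix.of fun i j : Fin 2 => if i.val + j.val + 1 = 2 then (1 : L) else 0)).Local v × (UnitaryGroup.cmDatum L 1 (Matrix.of fun i j : Fin 1 => if i.val + j.val + 1 = 1 then (1 : L) else 0)).Local v))) (mU : OrbitalMeasureFamily ((UnitaryGroup.cmDatum L 2 (Matrix.of fun i j : Fin 2 => if i.val + j.val + 1 = 2 then (1 : L) else 0)).Local v × (UnitaryGroup.cmDatum L 1 (Matrix.of fun i j : Fin 1 => if i.val + j.val + 1 = 1 then (1 : L) else 0)).Local v))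
      (Γ : ConjClasses ((UnitaryGroup.cmDatum L 2 (Matrix.of fun i j : Fin 2 => if i.val + j.val + 1 = 2 then (1 : L) else 0)).Local v × (UnitaryGroup.cmDatum L 1 (Matrix.of fun i j : Fin 1 => if i.val + j.val + 1 = 1 then (1 : L) else 0)).Local v) → (UnitaryGroup.cmDatum L 2 (Matrix.of fun i j : Fin 2 => if i.val + j.val + 1 = 2 then (1 : L) else 0)).Local v × (UnitaryGroup.cmDatum L 1 (Matrix.of fun i j : Fin 1 => if i.val + j.val + 1 = 1 then (1 : L) else 0)).Local v → ℂ),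
      ConjClasses.mk z ∈ S →
      (∀ u ∈ S, ((((Quotient.out u * z⁻¹).1).val : GL (Fin 2) (UnitaryGroup.LocalRing L v)).val - 1) ^ 2 = 0 ∧ (Quotient.out u * z⁻¹).2 = 1) →
      mU.IsAdmissibleOn (fun γ : (UnitaryGroup.cmDatum L 2 (Matrix.of fun i j : Fin 2 => if i.val + j.val + 1 = 2 then (1 : L) else 0)).Local v × (UnitaryGroup.cmDatum L 1 (Matrix.of fun i j : Fin 1 => if i.val + j.val + 1 = 1 then (1 : L) else 0)).Local v => ConjClasses.mk γ ∈ S) →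
      (∀ u ∈ S, ∀ fH : (UnitaryGroup.cmDatum L 2 (Matrix.of fun i j : Fin 2 => if i.val + j.val + 1 = 2 then (1 : L) else 0)).Local v × (UnitaryGroup.cmDatum L 1 (Matrix.of fun i j : Fin 1 => if i.val + j.val + 1 = 1 then (1 : L) else 0)).Local v → ℂ, IsLocSmooth fH →
        Integrable (descConj (Quotient.out u : (UnitaryGroup.cmDatum L 2 (Matrix.of fun i j : Fin 2 => if i.val + j.val + 1 = 2 then (1 : L) else 0)).Local v × (UnitaryGroup.cmDatum L 1 (Matrix.of fun i j : Fin 1 => if i.val + j.val + 1 = 1 then (1 : L) else 0)).Local v) (Subgroup.centralizer ({(Quotient.out u : (UnitaryGroup.cmDatum L 2 (Matrix.of fun i j : Fin 2 => if i.val + j.val + 1 = 2 then (1 : L) else 0)).Local v × (UnitaryGroup.cmDatum L 1 (Matrix.of fun i j : Fin 1 => if i.val + j.val + 1 = 1 then (1 : L) else 0)).Local v)} : Set ((UnitaryGroup.cmDatum L 2 (Matrix.of fun i j : Fin 2 => if i.val + j.val + 1 = 2 then (1 : L) else 0)).Local v × (UnitaryGroup.cmDatum L 1 (Matrix.of fun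 i j : Fin 1 => if i.val + j.val + 1 = 1 then (1 : L) else 0)).Local v)))
          (fun _ hg => Subgroup.mem_centralizer_singleton_iff.1 hg) fH) (mU u)) →
      (∀ fH : (UnitaryGroup.cmDatum L 2 (Matrix.of fun i j : Fin 2 => if i.val + j.val + 1 = 2 then (1 : L) else 0)).Local v × (UnitaryGroup.cmDatum L 1 (Matrix.of fun i j : Fin 1 => if i.val + j.val + 1 = 1 then (1 : L) else 0)).Local v → ℂ, IsLocSmooth fH → ∀ᶠ γ in 𝓝[{γ : (UnitaryGroup.cmDatum L 2 (Matrix.of fun i j : Fin 2 => if i.val + j.val + 1 = 2 then (1 : L) else 0)).Local v × (UnitaryGroup.cmDatum L 1 (Matrix.of fun i j : Fin 1 => if i.val + j.val + 1 = 1 then (1 : L) else 0)).Local v |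
            IsLocalGRegular L v γ ∧ CompactSpace (Subgroup.centralizer ({γ} : Set ((UnitaryGroup.cmDatum L 2 (Matrix.of fun i j : Fin 2 => if i.val + j.val + 1 = 2 then (1 : L) else 0)).Local v × (UnitaryGroup.cmDatum L 1 (Matrix.of fun i j : Fin 1 => if i.val + j.val + 1 = 1 then (1 : L) else 0)).Local v)))}] z,
          stableOrbitalIntegralRel (IsLocalStablyConjH L v) mHv fH γ = ∑ u ∈ S, classOrbitalIntegral mU fH u * Γ u γ) →
    ∀ (c₀ : ℂ) (a : ConjClasses ((UnitaryGroup.cmDatum L 2 (Matrix.of fun i j : Fin 2 => if i.val + j.val + 1 = 2 then (1 : L) else 0)).Local v × (UnitaryGroup.cmDatum L 1 (Matrix.of fun i j : Fin 1 => if i.val + j.val + 1 = 1 then (1 : L) else 0)).Local v) → ℂ), a (ConjClasses.mk z) = 0 →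
      (∀ᶠ γ in 𝓝[{γ : (UnitaryGroup.cmDatum L 2 (Matrix.of fun i j : Fin 2 => if i.val + j.val + 1 = 2 then (1 : L) else 0)).Local v × (UnitaryGroup.cmDatum L 1 (Matrix.of fun i j : Fin 1 => if i.val + j.val + 1 = 1 then (1 : L) else 0)).Local v |
            IsLocalGRegular L v γ ∧ CompactSpace (Subgroup.centralizer ({γ} : Set ((UnitaryGroup.cmDatum L 2 (Matrix.of fun i j : Fin 2 => if i.val + j.val + 1 = 2 then (1 : L) else 0)).Local v × (UnitaryGroup.cmDatum L 1 (Matrix.of fun i j : Fin 1 => if i.val + j.val + 1 = 1 then (1 : L) else 0)).Local v)))}] z,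
        c₀ + ∑ u ∈ S, a u * Γ u γ = 0) → c₀ = 0 := by
  classical
  intro L _ _ _ H' hherm hanis v _ _ _ _ _ _ _ _ νHv νGv _ _ _ _ Δv mHv mGv hdat hcanH hcanG hns z hz S mU Γ hzS hlit hadm hint hexp c₀ a ha0 h
  obtain ⟨ρ, w, hρ, hw, hhom⟩ := hHb L H' hherm hanis v νHv νGv Δv mHv mGv hdat hcanH hcanG hns z hz S mU Γ hzS hlit hadm hint hexp
  -- choose the homogeneity constants (0 for the central class and outside S)
  have hK : ∀ u, ∃ K : ℂ, u ∈ S → u ≠ ConjClasses.mk z → ∀ᶠ n in atTop, Γ u (ρ n) = (w n : ℂ) * K := by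
    intro u
    by_cases hu : u ∈ S
    · by_cases huz : u = ConjClasses.mk z
      · exact ⟨0, fun _ h' => absurd huz h'⟩
      · obtain ⟨K, hK⟩ := hhom u hu huz
        exact ⟨K, fun _ _ => hK⟩
    · exact ⟨0, fun h' => absurd h' hu⟩
  choose K hK using hK
  -- along ρ, eventually every non-central germ is w n * K u, and the combination vanishes
  have hall : ∀ᶠ n in atTop, ∀ u ∈ S, u ≠ ConjClasses.mk z → Γ u (ρ n) = (w n : ℂ) * K u := by
    have : ∀ u ∈ S, ∀ᶠ n in atTop, u ≠ ConjClasses.mk z → Γ u (ρ n) = (w n : ℂ) * K u := by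
      intro u hu
      by_cases huz : u = ConjClasses.mk z
      · exact Eventually.of_forall fun _ h' => absurd huz h'
      · exact (hK u hu huz).mono fun n hn _ => hn
    exact (S.eventually_all.2 this).mono fun n hn u hu => hn u hu
  have hpull : ∀ᶠ n in atTop, c₀ + ∑ u ∈ S, a u * Γ u (ρ n) = 0 := hρ.eventually h
  refine eq_zero_of_eventually_add_mul_eq_zero (K := ∑ u ∈ S, a u * K u) hw ?_
  filter_upwards [hall, hpull] with n h1 h2
  rw [Finset.mul_sum, ← h2]
  congr 1
  refine Finset.sum_congr rfl fun u hu => ?_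
  by_cases huz : u = ConjClasses.mk z
  · rw [huz, ha0, zero_mul, zero_mul, mul_zero]
  · rw [h1 u hu huz]; ring

end Summit.HodgeConjecture.HodgeConjecture.Cruxes.H413.K2E3CentralGermIndependenceOfHomogeneity

end
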